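import Mathlib
import HarnessLib
import Summits.FinalStateConjecture.FinalStateConjecture.Theses.DissipativeFinalMotions
import Summits.FinalStateConjecture.FinalStateConjecture.Theorems.DissipativeFinalMotionsFinalEraGenericOrientationHelpers

/-!
# Route DissipativeFinalMotions — crux `FinalEraGeneric` (stmt-FinalStateConjecture-17642), line `registered`:
# the far-zone flat orientation (F₀) of a rev-2 final era, and the honest form of `stub_orientationSpreads`

* `isFutureDirected_flat_farOut` — over a general spacetime `𝓢` with a Cauchy hypersurface `S` and ONE late
  flat chart `Ψ₀ : U₀ → 𝓢` into `O ⊆ J⁺(S)`: if `Ψ₀^* g − η` is `C⁰`-small (`≤ ε(V)`) at the late points of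
  `U₀` farther than `ϱ` from `N` worldlines `ξᵢ` of speed `≤ V < 1`, then at every late slab point OUTSIDE the
  ball of radius `|ξᵢ(τ)| + ϱ + 3` (all `i`) `dΨ₀(∂₀)` is future-directed: it is timelike; a past sign would
  pass to `dΨ₀(u)`, `u = (1, v x⃗/|x⃗|)`, `v = (1 + V)/2`, and the lift of the radially receding worldline
  `s ↦ x + (e^s − 1) u` (for ever in the controlled far zone: the holes recede no faster than `V < v`) would
  be a past-directed uniformly timelike ray in `Ψ₀(late region) ⊆ O ⊆ J⁺(S)` — impossible
  (`false_of_pastRay_subset_causalFuture`).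
* `eventually_isFutureDirected_flat` — clause (F₀) for one flat chart from (F1), (F2), (F3), (W3): a free
  spatial direction (`exists_free_direction`) joins a far slab point inside the controlled far slab to a
  point outside the ball containing the holes; one sign on the segment (`stub_oneSign`).
* `flatOrientation_of_isFinalEra₂` — (F₀) for EVERY tuple satisfying `IsFinalEra₂`;
  `stub_orientationSpreadsOnTubes` — the honest form of the registered stub: same antecedents ⇒ a rev-2 era
  with (R), hole charts future-oriented on the CERTIFIED tubes (radius `2ρ₀`), and (F₀).

References: O'Neill 1983, Ch. 5, Lemma 5.26 ff., Ch. 14, Lemma 14.29; Dafermos–Luk arXiv:1710.01722, p. 8.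
-/

noncomputable section

-- `<Problem> = <Summit>` doubles the namespace component (tree-wide convention)
set_option linter.dupNamespace false
-- instance search through nested operator types `E4 →L[ℝ] E4 →L[ℝ] ℝ`
set_option maxSynthPendingDepth 3

open Set Filter Topology Function
open scoped Manifold ContDiff ENNReal Topology
open Literature.Geometry.Lorentzian

namespace Summit.FinalStateConjecture.FinalStateConjecture.Theorems.DissipativeFinalMotions.FinalEraGeneric

-- one long causal-geometric assembly (curve, kinematics, lift, sign function): the default budget is too small
set_option maxHeartbeats 400000 in
/-- **Far-out late flat points are future-oriented** (see the module docstring): for a spacetime with a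
Cauchy hypersurface `S`, `O ⊆ J⁺(S)`, a late flat chart `Ψ₀` into `O` after `T` on `U₀`, worldlines `ξᵢ` of
speed `≤ V < 1` after `T`, `U₀ ⊇ {y⁰ > T, |y⃗ − ξᵢ(y⁰)| > ρ₀ ∀ i}`, deviation `≤ (1 − v²)/4`, `v = (1 + V)/2`, at
the points with `y⁰ ≥ T'` farther than `ϱ ≥ ρ₀ + 1` from all `ξᵢ(y⁰)`: at every `x` with `x⁰ = τ ≥ max (T + 1) T'`
and `|x⃗| ≥ |ξᵢ(τ)| + ϱ + 3` (all `i`), `|x⃗| ≥ 4`, the vector `dΨ₀(∂₀)` is future-directed (receding ray +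
`false_of_pastRay_subset_causalFuture`; adapted from `exists_forall_isFutureDirected_axis`). O'Neill 1983, Ch. 5,
Lemma 5.26; Ch. 14, Lemma 14.29. [folklore] -/
theorem isFutureDirected_flat_farOut (𝓢 : Spacetime.{0} 4) {S O : Set 𝓢.carrier}
    (hS : 𝓢.metric.IsCauchyHypersurface 𝓢.timeOrientation S)
    (hOS : O ⊆ 𝓢.metric.causalFuture 𝓢.timeOrientation S) (U₀ : TopologicalSpace.Opens E4)
    {T : ℝ} (Ψ₀ : (Minkowski.backgroundOn U₀).domain → 𝓢.carrier)
    (hΨ₀ : 𝓢.IsLateChart (Minkowski.backgroundOn U₀) O T Ψ₀)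
    {N : ℕ} (ξ : Fin N → ℝ → E3) {V : ℝ} (hV0 : 0 ≤ V) (hV1 : V < 1)
    (hlip : ∀ i s t, T ≤ s → s ≤ t → ‖ξ i t - ξ i s‖ ≤ V * (t - s))
    {ρ₀ : ℝ} (hU₀ : {y : E4 | T < y 0 ∧ ∀ i, ρ₀ < ‖E4.spatial y - ξ i (y 0)‖} ⊆ (U₀ : Set E4))
    {ϱ T' : ℝ} (hϱ : ρ₀ + 1 ≤ ϱ)
    (hdev : ∀ y : (Minkowski.backgroundOn U₀).domain, T' ≤ y.1 0 →
      (∀ i, ϱ ≤ ‖E4.spatial y.1 - ξ i (y.1 0)‖) →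
        ‖𝓢.deviation (Minkowski.backgroundOn U₀) Ψ₀ y‖ ≤ (1 - ((1 + V) / 2) ^ 2) / 4)
    {τ : ℝ} (hτT : T + 1 ≤ τ) (hτT' : T' ≤ τ) (x : (Minkowski.backgroundOn U₀).domain)
    (hx0 : x.1 0 = τ) (hfar : ∀ i, ‖ξ i τ‖ + ϱ + 3 ≤ E4.spatialNorm x.1)
    (hx4 : 4 ≤ E4.spatialNorm x.1) :
    𝓢.timeOrientation.IsFutureDirected (mfderiv 𝓘(ℝ, E4) (𝓡 4) Ψ₀ x (E4.basisVector 0)) := by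
  set v : ℝ := (1 + V) / 2 with hv
  set ε : ℝ := (1 - v ^ 2) / 4 with hε
  have hv0 : 0 < v := by rw [hv]; linarith
  have hv1 : v < 1 := by rw [hv]; linarith
  have hVv : V < v := by rw [hv]; linarith
  have hv2 : v ^ 2 < 1 := by nlinarith
  have hε0 : 0 < ε := by rw [hε]; linarith
  obtain ⟨k, hk⟩ : ∃ k : ℝ, k = (1 - v ^ 2) / 2 := ⟨_, rfl⟩
  have hk0 : 0 < k := by rw [hk]; linarith
  have hεk : -1 + v ^ 2 + ε * (1 + v ^ 2) ≤ -k := by rw [hε, hk]; nlinarith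
  have hε1 : ε * (1 + v ^ 2) < 1 := by rw [hε]; nlinarith
  -- spatial data of `x`: `q = x⃗`, `e = q/|q|`, `u = (1, v e)`
  obtain ⟨q, hq⟩ : ∃ q : E3, E4.spatial x.1 = q := ⟨_, rfl⟩
  have hqn : E4.spatialNorm x.1 = ‖q‖ := by rw [E4.spatialNorm, hq]
  have hq4 : 4 ≤ ‖q‖ := hqn ▸ hx4
  have hfar' : ∀ i, ‖ξ i τ‖ + ϱ + 3 ≤ ‖q‖ := fun i ↦ hqn ▸ hfar i
  have hq0 : 0 < ‖q‖ := by linarith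
  obtain ⟨e, he'⟩ : ∃ e : E3, e = ‖q‖⁻¹ • q := ⟨_, rfl⟩
  have he : ‖e‖ = 1 := by
    rw [he', norm_smul, norm_inv, norm_norm, inv_mul_cancel₀ hq0.ne']
  have hqe : ‖q‖ • e = q := by rw [he', smul_smul, mul_inv_cancel₀ hq0.ne', one_smul]
  obtain ⟨hu0, hun, -⟩ := receding_tangent v he
  obtain ⟨u, hu⟩ : ∃ u : E4, E4.ofTimeSpace 1 (v • e) = u := ⟨_, rfl⟩
  rw [hu] at hu0 hun
  have husp : E4.spatial u = v • e := by rw [← hu, E4.spatial_ofTimeSpace]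
  -- the receding worldline `Q s = x + (e^s − 1) u` and its kinematics
  have hφm1 : ∀ s : ℝ, -1 < Real.exp s - 1 := fun s ↦ by linarith [Real.exp_pos s]
  have hφ0 : ∀ s : ℝ, 0 ≤ s → 0 ≤ Real.exp s - 1 := fun s hs ↦ by
    linarith [Real.add_one_le_exp s]
  set Q : ℝ → E4 := fun s ↦ x.1 + (Real.exp s - 1) • u with hQ
  have hQ0 : ∀ s, Q s 0 = τ + (Real.exp s - 1) := fun s ↦ by
    simp only [hQ, PiLp.add_apply, PiLp.smul_apply, smul_eq_mul, hx0, hu0, mul_one]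
  have hQsp : ∀ s, E4.spatial (Q s) = (‖q‖ + (Real.exp s - 1) * v) • e := fun s ↦ by
    simp only [hQ, map_add, map_smul, husp, hq]
    rw [add_smul, hqe, smul_smul]
  have hQn : ∀ s, ‖E4.spatial (Q s)‖ = ‖q‖ + (Real.exp s - 1) * v := fun s ↦ by
    rw [hQsp, norm_smul, he, mul_one, Real.norm_eq_abs, abs_of_pos]
    nlinarith [mul_nonneg (by linarith [hφm1 s] : (0 : ℝ) ≤ Real.exp s - 1 + 1) hv0.le]
  -- distance to the holes along the worldline: `≥ ϱ + 1`
  have hdist : ∀ s i, ϱ + 1 ≤ ‖E4.spatial (Q s) - ξ i (τ + (Real.exp s - 1))‖ := by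
    intro s i
    have hTτ : T ≤ τ := by linarith
    have hξ : ‖ξ i (τ + (Real.exp s - 1))‖ ≤ ‖ξ i τ‖ + V * |Real.exp s - 1| := by
      have hn := norm_sub_norm_le (ξ i (τ + (Real.exp s - 1))) (ξ i τ)
      rcases le_or_gt 0 (Real.exp s - 1) with h0 | h0
      · have h1 := hlip i τ (τ + (Real.exp s - 1)) hTτ (by linarith)
        have h1' : V * (τ + (Real.exp s - 1) - τ) = V * |Real.exp s - 1| := by
          rw [abs_of_nonneg h0]; ring
        linarith
      · have h1 := hlip i (τ + (Real.exp s - 1)) τ (by linarith [hφm1 s]) (by linarith)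
        have h1' : V * (τ - (τ + (Real.exp s - 1))) = V * |Real.exp s - 1| := by
          rw [abs_of_neg h0]; ring
        rw [norm_sub_rev] at h1
        linarith
    have h2 : ‖E4.spatial (Q s)‖ - ‖ξ i (τ + (Real.exp s - 1))‖ ≤
        ‖E4.spatial (Q s) - ξ i (τ + (Real.exp s - 1))‖ := norm_sub_norm_le _ _
    have h3 : -2 ≤ (Real.exp s - 1) * v - V * |Real.exp s - 1| := by
      rcases le_or_gt 0 (Real.exp s - 1) with h0 | h0
      · rw [abs_of_nonneg h0]; nlinarith
      · rw [abs_of_neg h0]; nlinarith [hφm1 s]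
    have h4 := hfar' i
    rw [hQn] at h2
    linarith
  -- the worldline stays in `U₀`
  have hQU : ∀ s, Q s ∈ (U₀ : Set E4) := fun s ↦ by
    refine hU₀ ⟨?_, fun i ↦ ?_⟩
    · rw [hQ0]; linarith [hφm1 s]
    · rw [hQ0]; linarith [hdist s i]
  set cur : ℝ → (Minkowski.backgroundOn U₀).domain := fun s ↦ ⟨Q s, hQU s⟩ with hcur
  have hcurval : ∀ s : ℝ, (cur s : E4) = Q s := fun s ↦ rfl
  have hcur0 : cur 0 = x := Subtype.ext (by simp [hcur, hQ])
  -- deviation bounds along the worldline for `s ≥ 0`, and at `x`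
  have hdevs : ∀ s, 0 ≤ s → ‖𝓢.deviation (Minkowski.backgroundOn U₀) Ψ₀ (cur s)‖ ≤ ε := by
    intro s hs
    refine hdev (cur s) ?_ fun i ↦ ?_
    · show T' ≤ Q s 0
      rw [hQ0]; linarith [hφ0 s hs]
    · show ϱ ≤ ‖E4.spatial (Q s) - ξ i (Q s 0)‖
      rw [hQ0]; linarith [hdist s i]
  have hdevx : ‖𝓢.deviation (Minkowski.backgroundOn U₀) Ψ₀ x‖ ≤ ε := by
    have h := hdevs 0 le_rfl
    rwa [hcur0] at h
  -- the lifted worldline `γ = Ψ₀ ∘ cur`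
  have hQdiff : ContDiff ℝ ∞ Q :=
    contDiff_const.add ((Real.contDiff_exp.sub contDiff_const).smul contDiff_const)
  have hQ' : ∀ t, HasDerivAt Q (Real.exp t • u) t := fun t ↦
    (((Real.hasDerivAt_exp t).sub_const 1).smul_const u).const_add x.1
  obtain ⟨hγ, hvel⟩ := curve_lift hΨ₀.contMDiff hQdiff hQ' (c := cur) hcurval
  set γ : ℝ → 𝓢.carrier := Ψ₀ ∘ cur with hγdef
  -- at `x`: `dΨ₀ ∂₀` is timelike, hence future- or past-directed
  obtain ⟨hxa, -, hxc⟩ := flat_cone_bounds 𝓢 U₀ Ψ₀ x hε0.le hdevx v he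
  rw [hu] at hxc
  have hε1' : ε < 1 := by rw [hε]; nlinarith
  have hxt : 𝓢.metric.IsTimelike (mfderiv 𝓘(ℝ, E4) (𝓡 4) Ψ₀ x (E4.basisVector 0)) :=
    lt_of_le_of_lt hxa (by linarith only [hε1'])
  -- `dΨ₀_x u` is timelike as well
  have hxu : 𝓢.metric.val (Ψ₀ x) (mfderiv 𝓘(ℝ, E4) (𝓡 4) Ψ₀ x u)
      (mfderiv 𝓘(ℝ, E4) (𝓡 4) Ψ₀ x u) ≤ -k := by
    obtain ⟨-, hb, -⟩ := flat_cone_bounds 𝓢 U₀ Ψ₀ x hε0.le hdevx v he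
    rw [hu] at hb
    exact hb.trans hεk
  rcases 𝓢.timeOrientation.isFutureDirected_or_isPastDirected_of_isCausal hxt.isCausal with
    hfut | hpast
  · exact hfut
  exfalso
  -- speed bound along the ray for `s ≥ 0`
  have hcone : ∀ s, 0 ≤ s →
      𝓢.metric.val (Ψ₀ (cur s)) (mfderiv 𝓘(ℝ, E4) (𝓡 4) Ψ₀ (cur s) u)
        (mfderiv 𝓘(ℝ, E4) (𝓡 4) Ψ₀ (cur s) u) ≤ -k := by
    intro s hs
    obtain ⟨-, hb, -⟩ := flat_cone_bounds 𝓢 U₀ Ψ₀ (cur s) hε0.le (hdevs s hs) v he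
    rw [hu] at hb
    exact hb.trans hεk
  have hspeed : ∀ s : ℝ, 0 ≤ s →
      𝓢.metric.val (γ s) (velocity (𝓡 4) γ s) (velocity (𝓡 4) γ s) ≤ -k := by
    intro s hs
    have hms : mfderiv 𝓘(ℝ, E4) (𝓡 4) Ψ₀ (cur s) (Real.exp s • u) =
        Real.exp s • mfderiv 𝓘(ℝ, E4) (𝓡 4) Ψ₀ (cur s) u :=
      (mfderiv 𝓘(ℝ, E4) (𝓡 4) Ψ₀ (cur s)).map_smul (Real.exp s) u
    have key : 𝓢.metric.val (Ψ₀ (cur s))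
        (Real.exp s • mfderiv 𝓘(ℝ, E4) (𝓡 4) Ψ₀ (cur s) u)
        (Real.exp s • mfderiv 𝓘(ℝ, E4) (𝓡 4) Ψ₀ (cur s) u) ≤ -k := by
      rw [val_smul_smul]
      have h1 : 1 ≤ Real.exp s * Real.exp s := by nlinarith only [Real.add_one_le_exp s, hs]
      have h2 := hcone s hs
      have h3 : Real.exp s * Real.exp s *
          𝓢.metric.val (Ψ₀ (cur s)) (mfderiv 𝓘(ℝ, E4) (𝓡 4) Ψ₀ (cur s) u)
            (mfderiv 𝓘(ℝ, E4) (𝓡 4) Ψ₀ (cur s) u) ≤ Real.exp s * Real.exp s * (-k) :=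
        mul_le_mul_of_nonneg_left h2 (by positivity)
      have h4 : Real.exp s * Real.exp s * (-k) ≤ -k := by nlinarith only [h1, hk0]
      exact h3.trans h4
    rw [(hvel s).2, hms]
    exact key
  have htl : ∀ s : ℝ, 0 ≤ s → 𝓢.metric.IsTimelike (velocity (𝓡 4) γ s) := fun s hs ↦
    lt_of_le_of_lt (hspeed s hs) (neg_lt_zero.mpr hk0)
  -- the sign function `f(s) = g(T, γ')(s)` is continuous, nowhere zero on `[0, ∞)`, positive at `0`
  set f : ℝ → ℝ := fun s ↦
    𝓢.metric.val (γ s) (𝓢.timeOrientation.vectorField (γ s)) (velocity (𝓡 4) γ s) with hf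
  have hcont : Continuous f :=
    (LorentzianMetric.continuous_val_snd_snd 𝓢.metric 𝓢.timeOrientation).2.comp
      (LorentzianMetric.continuous_tangentLift (hγ.of_le one_le_infty'))
  have hne : ∀ s : ℝ, 0 ≤ s → f s ≠ 0 := fun s hs ↦
    𝓢.metric.val_ne_zero_of_isTimelike_of_isCausal (𝓢.timeOrientation.isTimelike _)
      (htl s hs).isCausal
  -- at `s = 0`: `γ' = dΨ₀_x u` is past-directed, by the handshake with `dΨ₀_x ∂₀`
  have hpast_u : 𝓢.timeOrientation.IsPastDirected (mfderiv 𝓘(ℝ, E4) (𝓡 4) Ψ₀ x u) := by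
    have hcu : 𝓢.metric.IsCausal (mfderiv 𝓘(ℝ, E4) (𝓡 4) Ψ₀ x u) :=
      (show 𝓢.metric.IsTimelike _ from lt_of_le_of_lt hxu (neg_lt_zero.mpr hk0)).isCausal
    exact isPastDirected_of_val_lt_zero 𝓢 hpast hxt hcu (by linarith only [hxc, hε1])
  have hf0 : 0 < f 0 := by
    have hF0 : 0 < 𝓢.metric.val (Ψ₀ (cur 0)) (𝓢.timeOrientation.vectorField (Ψ₀ (cur 0)))
        (mfderiv 𝓘(ℝ, E4) (𝓡 4) Ψ₀ (cur 0) (Real.exp 0 • u)) := by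
      rw [Real.exp_zero, one_smul, hcur0]
      exact hpast_u.2
    have he0 : f 0 = 𝓢.metric.val (Ψ₀ (cur 0)) (𝓢.timeOrientation.vectorField (Ψ₀ (cur 0)))
        (mfderiv 𝓘(ℝ, E4) (𝓡 4) Ψ₀ (cur 0) (Real.exp 0 • u)) := by
      simp only [hf]
      rw [(hvel 0).2]
      rfl
    rw [he0]
    exact hF0
  have hfpos : ∀ s : ℝ, 0 ≤ s → 0 < f s := by
    intro s hs
    by_contra hfs
    have hfs' : f s ≤ 0 := not_lt.mp hfs
    obtain ⟨r, hr, hr0⟩ := intermediate_value_Icc' hs hcont.continuousOn ⟨hfs', hf0.le⟩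
    exact hne r hr.1 hr0
  -- the ray stays in the chart image of the late region, hence in `O ⊆ J⁺(S)`
  have hmem : ∀ s : ℝ, 0 ≤ s → γ s ∈ 𝓢.metric.causalFuture 𝓢.timeOrientation S := by
    intro s hs
    have h1 : γ s ∈ Ψ₀ '' (Minkowski.backgroundOn U₀).lateRegion T := by
      refine mem_image_of_mem Ψ₀ ?_
      show T < Q s 0
      rw [hQ0]; linarith [hφm1 s]
    exact hOS (hΨ₀.image_subset h1)
  have hray : ∀ s : ℝ, 0 ≤ s → MDifferentiableAt 𝓘(ℝ, ℝ) (𝓡 4) γ s ∧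
      𝓢.metric.val (γ s) (velocity (𝓡 4) γ s) (velocity (𝓡 4) γ s) ≤ -k ∧
      𝓢.timeOrientation.IsPastDirected (velocity (𝓡 4) γ s) := fun s hs ↦
    ⟨(hvel s).1, hspeed s hs, (htl s hs).isCausal, hfpos s hs⟩
  exact NeckGapDecay.ConnectionLevelCones.OrientationAnchorStub.false_of_pastRay_subset_causalFuture
    (g := 𝓢.metric) (τ := 𝓢.timeOrientation) (γ := γ) two_le_infty' hS hk0 hray hmem

/-- **Far-zone flat orientation, single chart** (clause (F₀)): for a spacetime with a Cauchy hypersurface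
`S`, `O ⊆ J⁺(S)`, a late flat chart `Ψ₀` into `O` after `T` on `U₀` ((F1)), worldlines `ξᵢ` of speed
`≤ V < 1` after `T` ((P), (W3)), `U₀ ⊇ {y⁰ > T, |y⃗ − ξᵢ(y⁰)| > ρ₀ ∀ i}` ((F2)) and uniform `Cᵏ` flatness far
from the holes ((F3)), there is `ϱ₀` such that eventually in `τ`, `dΨ₀(∂₀)` is future-directed on the flat
slab `{y⁰ = τ}` farther than `ϱ₀` from all `ξᵢ(τ)` (`ε = ε(V)`, `ϱ = max ϱ₁ (ρ₀ + 1) 1`, `ϱ₀ = (3 + 2N²)ϱ`; free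
direction, `isFutureDirected_flat_farOut` at the far end, one sign on the segment).
O'Neill 1983, Ch. 5, Lemma 5.26 ff., p. 145; Ch. 14, Lemma 14.29. [folklore] -/
theorem eventually_isFutureDirected_flat (𝓢 : Spacetime.{0} 4) {S O : Set 𝓢.carrier}
    (hS : 𝓢.metric.IsCauchyHypersurface 𝓢.timeOrientation S)
    (hOS : O ⊆ 𝓢.metric.causalFuture 𝓢.timeOrientation S) (U₀ : TopologicalSpace.Opens E4)
    {T : ℝ} (Ψ₀ : (Minkowski.backgroundOn U₀).domain → 𝓢.carrier)
    (hΨ₀ : 𝓢.IsLateChart (Minkowski.backgroundOn U₀) O T Ψ₀)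
    {N : ℕ} (ξ : Fin N → ℝ → E3) {V : ℝ} (hV0 : 0 ≤ V) (hV1 : V < 1)
    (hlip : ∀ i s t, T ≤ s → s ≤ t → ‖ξ i t - ξ i s‖ ≤ V * (t - s))
    {ρ₀ : ℝ} (hU₀ : {y : E4 | T < y 0 ∧ ∀ i, ρ₀ < ‖E4.spatial y - ξ i (y 0)‖} ⊆ (U₀ : Set E4))
    {k : ℕ} (hF3 : ∀ ε : ℝ, 0 < ε → ∃ ϱ T' : ℝ, ∀ τ, T' ≤ τ →
      supCkENorm (Subtype.val '' {y : (Minkowski.backgroundOn U₀).domain |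
        y.1 0 = τ ∧ ∀ i, ϱ ≤ ‖E4.spatial y.1 - ξ i τ‖}) k
          (𝓢.deviationExtend (Minkowski.backgroundOn U₀) Ψ₀) ≤ ENNReal.ofReal ε) :
    ∃ ϱ₀ : ℝ, ∀ᶠ τ in atTop, ∀ x ∈ (Minkowski.backgroundOn U₀).timeSlab τ,
      (∀ i, ϱ₀ ≤ ‖E4.spatial x.1 - ξ i τ‖) →
        𝓢.timeOrientation.IsFutureDirected (mfderiv 𝓘(ℝ, E4) (𝓡 4) Ψ₀ x (E4.basisVector 0)) := by
  -- the tolerance `ε(V)` and the controlled radius `ϱ`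
  obtain ⟨ε, hε⟩ : ∃ ε : ℝ, ε = (1 - ((1 + V) / 2) ^ 2) / 4 := ⟨_, rfl⟩
  have hε0 : 0 < ε := by rw [hε]; nlinarith
  have hε1 : ε < 1 := by rw [hε]; nlinarith
  obtain ⟨ϱ₁, T', hb⟩ := hF3 ε hε0
  obtain ⟨ϱ, hϱ⟩ : ∃ ϱ : ℝ, ϱ = max (max ϱ₁ (ρ₀ + 1)) 1 := ⟨_, rfl⟩
  have hϱ₁ : ϱ₁ ≤ ϱ := by rw [hϱ]; exact (le_max_left _ _).trans (le_max_left _ _)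
  have hϱρ : ρ₀ + 1 ≤ ϱ := by rw [hϱ]; exact (le_max_right _ _).trans (le_max_left _ _)
  have hϱ1 : 1 ≤ ϱ := by rw [hϱ]; exact le_max_right _ _
  have hdev : ∀ y : (Minkowski.backgroundOn U₀).domain, T' ≤ y.1 0 →
      (∀ i, ϱ ≤ ‖E4.spatial y.1 - ξ i (y.1 0)‖) →
        ‖𝓢.deviation (Minkowski.backgroundOn U₀) Ψ₀ y‖ ≤ (1 - ((1 + V) / 2) ^ 2) / 4 := by
    intro y hy hyfar
    rw [← hε]
    exact norm_deviation_le_of_supCkENorm_le 𝓢 _ Ψ₀ hε0.le (hb (y.1 0) hy) y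
      ⟨rfl, fun i ↦ hϱ₁.trans (hyfar i)⟩
  refine ⟨(3 + 2 * (N : ℝ) ^ 2) * ϱ, ?_⟩
  filter_upwards [eventually_ge_atTop (max (T + 1) T')] with τ hτ
  have hτT : T + 1 ≤ τ := (le_max_left _ _).trans hτ
  have hτT' : T' ≤ τ := (le_max_right _ _).trans hτ
  intro x hx hxfar
  have hx0 : x.1 0 = τ := hx
  -- a free direction `w` and the spatial segment `r ↦ x + r (0, w)`, `0 ≤ r ≤ R`
  obtain ⟨w, hw1, hwfree⟩ := exists_free_direction N (fun i ↦ ξ i τ) (E4.spatial x.1) ϱ hxfar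
  obtain ⟨R, hR⟩ : ∃ R : ℝ, R = ‖E4.spatial x.1‖ + ∑ i, ‖ξ i τ‖ + ϱ + 3 := ⟨_, rfl⟩
  have hsum : 0 ≤ ∑ i, ‖ξ i τ‖ := Finset.sum_nonneg fun i _ ↦ norm_nonneg _
  have hR0 : 0 ≤ R := by
    rw [hR]; linarith only [norm_nonneg (E4.spatial x.1), hsum, hϱ1]
  obtain ⟨ŵ, hŵ⟩ : ∃ ŵ : E4, ŵ = E4.ofTimeSpace 0 w := ⟨_, rfl⟩
  have hŵ0 : ŵ 0 = 0 := by rw [hŵ]; exact E4.ofTimeSpace_apply_zero 0 w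
  have hŵsp : E4.spatial ŵ = w := by rw [hŵ]; exact E4.spatial_ofTimeSpace 0 w
  have hz0 : ∀ r : ℝ, (x.1 + r • ŵ) 0 = τ := fun r ↦ by
    simp only [PiLp.add_apply, PiLp.smul_apply, smul_eq_mul, hx0, hŵ0, mul_zero, add_zero]
  have hzsp : ∀ r : ℝ, E4.spatial (x.1 + r • ŵ) = E4.spatial x.1 + r • w := fun r ↦ by
    simp only [map_add, map_smul, hŵsp]
  have hzfar : ∀ (r : ℝ) i, ϱ ≤ ‖E4.spatial (x.1 + r • ŵ) - ξ i τ‖ := fun r i ↦ by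
    rw [hzsp]; exact hwfree i r
  have hzU : ∀ r : ℝ, x.1 + r • ŵ ∈ (U₀ : Set E4) := fun r ↦ by
    refine hU₀ ⟨?_, fun i ↦ ?_⟩
    · rw [hz0]; linarith only [hτT]
    · rw [hz0]; linarith only [hzfar r i, hϱρ]
  -- `dΨ₀(∂₀)` is causal along the segment
  have hcaus : ∀ z : (Minkowski.backgroundOn U₀).domain,
      (z : E4) ∈ (fun r : ℝ ↦ x.1 + r • ŵ) '' Icc 0 R →
        𝓢.metric.IsCausal (mfderiv 𝓘(ℝ, E4) (𝓡 4) Ψ₀ z (E4.basisVector 0)) := by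
    rintro z ⟨r, -, hzr⟩
    have hz0' : z.1 0 = τ := by rw [← hzr]; exact hz0 r
    have hdz : ‖𝓢.deviation (Minkowski.backgroundOn U₀) Ψ₀ z‖ ≤ (1 - ((1 + V) / 2) ^ 2) / 4 := by
      refine hdev z (by rw [hz0']; exact hτT') fun i ↦ ?_
      rw [hz0', ← hzr]
      exact hzfar r i
    rw [← hε] at hdz
    obtain ⟨ha, -, -⟩ := flat_cone_bounds 𝓢 U₀ Ψ₀ z hε0.le hdz 0 (e := ‖w‖⁻¹ • w)
      (by rw [norm_smul, norm_inv, norm_norm, inv_mul_cancel₀ (by linarith only [hw1])])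
    exact (show 𝓢.metric.IsTimelike _ from lt_of_le_of_lt ha (by linarith only [hε1])).isCausal
  -- the far end `x' = x + R (0, w)` lies outside the ball containing all the holes
  set x' : (Minkowski.backgroundOn U₀).domain := ⟨x.1 + R • ŵ, hzU R⟩ with hx'
  have hx'n : R - ‖E4.spatial x.1‖ ≤ E4.spatialNorm x'.1 := by
    show R - ‖E4.spatial x.1‖ ≤ ‖E4.spatial (x.1 + R • ŵ)‖
    rw [hzsp]
    have h1 : ‖R • w‖ ≤ ‖E4.spatial x.1 + R • w‖ + ‖E4.spatial x.1‖ := by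
      have h := norm_sub_le (E4.spatial x.1 + R • w) (E4.spatial x.1)
      rwa [add_sub_cancel_left] at h
    have h2 : R ≤ ‖R • w‖ := by
      rw [norm_smul, Real.norm_eq_abs, abs_of_nonneg hR0]
      nlinarith only [hw1, hR0]
    linarith only [h1, h2]
  have hx'far : ∀ i, ‖ξ i τ‖ + ϱ + 3 ≤ E4.spatialNorm x'.1 := fun i ↦ by
    have h1 : ‖ξ i τ‖ ≤ ∑ j, ‖ξ j τ‖ :=
      Finset.single_le_sum (fun j _ ↦ norm_nonneg (ξ j τ)) (Finset.mem_univ i)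
    rw [hR] at hx'n
    linarith only [hx'n, h1]
  have hx'4 : 4 ≤ E4.spatialNorm x'.1 := by
    rw [hR] at hx'n; linarith only [hx'n, hsum, hϱ1]
  have hfut' : 𝓢.timeOrientation.IsFutureDirected
      (mfderiv 𝓘(ℝ, E4) (𝓡 4) Ψ₀ x' (E4.basisVector 0)) :=
    isFutureDirected_flat_farOut 𝓢 hS hOS U₀ Ψ₀ hΨ₀ ξ hV0 hV1 hlip hU₀ hϱρ hdev hτT hτT' x'
      (hz0 R) hx'far hx'4
  -- one sign along the segment
  have hpre : IsPreconnected ((fun r : ℝ ↦ x.1 + r • ŵ) '' Icc 0 R) :=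
    isPreconnected_Icc.image _ ((continuous_const.add (continuous_id.smul continuous_const)).continuousOn)
  have hSO : (fun r : ℝ ↦ x.1 + r • ŵ) '' Icc 0 R ⊆ ((Minkowski.backgroundOn U₀).domain : Set E4) := by
    rintro _ ⟨r, -, rfl⟩
    exact hzU r
  have hxS : (x : E4) ∈ (fun r : ℝ ↦ x.1 + r • ŵ) '' Icc 0 R := ⟨0, ⟨le_rfl, hR0⟩, by simp⟩
  have hx'S : (x' : E4) ∈ (fun r : ℝ ↦ x.1 + r • ŵ) '' Icc 0 R := ⟨R, ⟨hR0, le_rfl⟩, rfl⟩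
  exact FutureOrientedOfSeamed.ClockDualityRays.stub_oneSign 𝓢 (Minkowski.backgroundOn U₀) Ψ₀
    hΨ₀.contMDiff (fun _ ↦ E4.basisVector 0) continuousOn_const hpre hSO hcaus x' hx'S hfut' x hxS

/-- **Clause (F₀) holds for every rev-2 final era of a Cauchy development.** For a tuple satisfying
`IsFinalEra₂` (FinalEraPackage2), there is `ϱ₀` such that, eventually in `τ`, the flat chart's
`dΨ₀(∂₀)` is future-directed at every point of the flat slab `{y⁰ = τ}` at flat distance `≥ ϱ₀` from
all the holes `ξᵢ(τ)`: `eventually_isFutureDirected_flat` fed by clause (O) (`O ⊆ J⁺(ι X)`, `ι X` the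
Cauchy hypersurface of the development), (B) (`B₀` is the Minkowski background on `U₀`), (P)
(`0 ≤ V < 1`), (W3) (speed bound), (F1) (late flat chart), (F2), (F3). Dafermos–Luk, arXiv:1710.01722,
p. 8 (the picture); O'Neill 1983, Ch. 5, Lemma 5.26 and Ch. 14, Lemma 14.29 (the proof). [folklore] -/
theorem flatOrientation_of_isFinalEra₂ {X : Type} [TopologicalSpace X] [ChartedSpace E3 X]
    [IsManifold (𝓡 3) ∞ X] [ConnectedSpace X] {D : InitialDataSet (𝓡 3) X}
    {𝒟 : CauchyDevelopment D} {N : ℕ} {M a : Fin N → ℝ} {T δ V C₁ C₂ ρ₀ κ : ℝ}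
    {ξ : Fin N → ℝ → E3} {β : ℝ → ℝ} {U₀ : TopologicalSpace.Opens E4} {B₀ : ModelBackground}
    {B : Fin N → ModelBackground} {Ψ₀ : B₀.domain → 𝒟.carrier}
    {Ψ : (i : Fin N) → (B i).domain → 𝒟.carrier} {O : Set 𝒟.carrier}
    (h : 𝒟.IsFinalEra₂ N M a T δ V C₁ C₂ ρ₀ κ ξ β U₀ B₀ B Ψ₀ Ψ O) :
    ∃ ϱ₀ : ℝ, ∀ᶠ τ in atTop, ∀ x ∈ B₀.timeSlab τ, (∀ i, ϱ₀ ≤ ‖E4.spatial x.1 - ξ i τ‖) →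
      𝒟.toSpacetime.timeOrientation.IsFutureDirected
        (mfderiv 𝓘(ℝ, E4) (𝓡 4) Ψ₀ x (E4.basisVector 0)) := by
  obtain ⟨h₁, h₂, -, -, -, h₆, h₇, -, -, -, -, -, -, h₁₄, -, -, -, h₁₈, h₁₉, h₂₀, -⟩ := h
  subst h₂
  have hOS : O ⊆ 𝒟.metric.causalFuture 𝒟.timeOrientation (range 𝒟.embed) := by
    rw [h₁]; exact inter_subset_left
  exact eventually_isFutureDirected_flat 𝒟.toSpacetime 𝒟.isCauchyHypersurface hOS U₀ Ψ₀ h₁₈ ξ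
    h₆ h₇ h₁₄ h₁₉ h₂₀

/-- **Registered stub `stub_orientationSpreadsOnTubes`, the honest form of `stub_orientationSpreads`: orientation
on the certified tubes is kept as is, and the far flat zone is oriented (F₀).** For an admissible datum, a maximal development
with complete `𝓘⁺`, and a rev-2 era package with (R) whose hole charts are future-oriented on the
certified tubes `{t*ᵢ = τ, rᵢ ≤ 2ρ₀}`, `τ > T`, there is a rev-2 era package of the same development
(the same one) with (R), with the hole charts future-oriented on the certified tubes, and with (F₀)
(`flatOrientation_of_isFinalEra₂`). The registered stub asks instead for (F) at EVERY radius `ρ`, which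
the 31 clauses do not control beyond `2ρ₀` when another hole is near (no metric information on
`{2ρ₀ < rᵢ ≤ ρ}` outside the effacement regime (H3)). [folklore] -/
theorem stub_orientationSpreadsOnTubes : open scoped Manifold in ∀ (X : Type) [TopologicalSpace X] [ChartedSpace (EuclideanSpace ℝ (Fin 3)) X] [IsManifold (𝓡 3) ((⊤ : ℕ∞) : WithTop ℕ∞) X] [T2Space X] [SecondCountableTopology X] [ConnectedSpace X], ∀ D ∈ Literature.Geometry.Lorentzian.admissibleVacuumData X, ∀ 𝒟 : Literature.Geometry.Lorentzian.VacuumCauchyDevelopment D, 𝒟.IsMaximal → Summit.FinalStateConjecture.HasCompleteNullInfinity 𝒟.toCauchyDevelopment → ∀ (N : ℕ) (M a : Fin N → ℝ) (T δ V C₁ C₂ ρ₀ κ : ℝ) (ξ : Fin N → ℝ → EuclideanSpace ℝ (Fin 3)) (β : ℝ → ℝ) (U₀ : TopologicalSpace.Opens Literature.Geometry.Lorentzian.E4) (B₀ : Literature.Geometry.Lorentzian.ModelBackground) (B : Fin N → Literature.Geometry.Lorentzian.ModelBackground) (Ψ₀ : B₀.domain → 𝒟.carrier) (Ψ : (i :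 Fin N) → (B i).domain → 𝒟.carrier) (O : Set 𝒟.carrier), 𝒟.toCauchyDevelopment.IsFinalEra₂ N M a T δ V C₁ C₂ ρ₀ κ ξ β U₀ B₀ B Ψ₀ Ψ O → Summit.FinalStateConjecture.RaysStayInClosure 𝒟.toCauchyDevelopment O → (∀ i (τ : ℝ), T < τ → ∀ x ∈ (B i).truncTimeSlab (2 * ρ₀) τ, 𝒟.toSpacetime.timeOrientation.IsFutureDirected (mfderiv 𝓘(ℝ, Literature.Geometry.Lorentzian.E4) (𝓡 4) (Ψ i) x (Literature.Geometry.Lorentzian.Kerr.timeVector (M i) (a i) x.1))) → ∃ (N : ℕ) (M a : Fin N → ℝ) (T δ V C₁ C₂ ρ₀ κ : ℝ) (ξ : Fin N → ℝ → EuclideanSpace ℝ (Fin 3)) (β : ℝ → ℝ) (U₀ : TopologicalSpace.Opens Literature.Geometry.Lorentzian.E4) (B₀ : Literature.Geometry.Lorentzian.ModelBackground) (B : Fin N → Literature.Geometry.Lorentzian.ModelBackground) (Ψ₀ : B₀.domain → 𝒟.carrier) (Ψ : (i : Fin N) → (B i).domain → 𝒟.carrier) (O : Set 𝒟.carrier),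 𝒟.toCauchyDevelopment.IsFinalEra₂ N M a T δ V C₁ C₂ ρ₀ κ ξ β U₀ B₀ B Ψ₀ Ψ O ∧ Summit.FinalStateConjecture.RaysStayInClosure 𝒟.toCauchyDevelopment O ∧ (∀ i (τ : ℝ), T < τ → ∀ x ∈ (B i).truncTimeSlab (2 * ρ₀) τ, 𝒟.toSpacetime.timeOrientation.IsFutureDirected (mfderiv 𝓘(ℝ, Literature.Geometry.Lorentzian.E4) (𝓡 4) (Ψ i) x (Literature.Geometry.Lorentzian.Kerr.timeVector (M i) (a i) x.1))) ∧ (∃ ϱ₀ : ℝ, ∀ᶠ τ in Filter.atTop, ∀ x ∈ B₀.timeSlab τ, (∀ i, ϱ₀ ≤ ‖Literature.Geometry.Lorentzian.E4.spatial x.1 - ξ i τ‖) → 𝒟.toSpacetime.timeOrientation.IsFutureDirected (mfderiv 𝓘(ℝ, Literature.Geometry.Lorentzian.E4) (𝓡 4) Ψ₀ x (Literature.Geometry.Lorentzian.E4.basisVector 0))) := by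
  intro X _ _ _ _ _ _ D _ 𝒟 _ _ N M a T δ V C₁ C₂ ρ₀ κ ξ β U₀ B₀ B Ψ₀ Ψ O hera hR htube
  exact ⟨N, M, a, T, δ, V, C₁, C₂, ρ₀, κ, ξ, β, U₀, B₀, B, Ψ₀, Ψ, O, hera, hR, htube,
    flatOrientation_of_isFinalEra₂ hera⟩

end Summit.FinalStateConjecture.FinalStateConjecture.Theorems.DissipativeFinalMotions.FinalEraGeneric

end
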